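import Summits.CriticalPhenomena.PercolationContinuityZ3.Theorems.PercNearOneGluingNoHeavyLowerTailSunflowerLawPencilForms
import Literature.Probability.Percolation.FourFunctionsProdBernoulli
import Summits.CriticalPhenomena.PercolationContinuityZ3.Theorems.PercNearOneGluingNoHeavyQuantLevelTrials
import HarnessLib

/-!
# `NoHeavyLowerTail` (crux stmt-CriticalPhenomena-4575), abstract sunflower cubic at LAW level: FIRST-ORDER STABILITY OF THE PRODUCT CLASS —
# every sunflower dominating a product-class structure PC(W₁,W₂,W₃) satisfies the linearized (C1-law) at the sheet `{LB = 0}`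

Support file (seat `prim-ineq-gen-2` gen 30; `--supports stmt-CriticalPhenomena-4575`).  Nothing is asserted about the crux; no `sorry`, no named facts,
standard axioms.  Memo: run/shared/lean/prim/prim-ineq-gen-2/LAW-REGION-GEN30.md §7.  Uses `LawPencil.cells` / `LawPencil.mixedLB` (gen 29), the tree's
four-events form of Ahlswede–Daykin (`prodBernoulli_fourEvents`), coordinate independence (`prodBernoulli_real_inter_of_determinedBy_disjoint`)
and the QUANT lane's `Quant.determinedBy_compl_of`.

SETTING.  `W i` (`i : Fin 3`) up-sets of the cube `Set ι` determined by pairwise disjoint coordinate blocks `X i`; the PRODUCT-CLASS structure PC(W) labels a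
configuration `B` if no `W i` occurs, `C_i` if exactly `W i` occurs, `A` if at least two occur (gen 29: its laws fill the sheet `{LB = 0}` of the law region,
where `LB = b·AG − e₃` is Lemma B's slack).  A sunflower `(E 0, E 1, E 2; A)` of up-sets DOMINATES PC(W) if `W i ⊆ E i` for all `i` (then `E i ⊇ W i ∪ (W j ∩ W k)`:
exactly the sunflowers `θ₁ ≥ θ₀ = PC` pointwise, i.e. the contractions `θ/e` of structures `θ` whose deletion `θ∖e` is PC).
Cells of the promotion: `P i = B⁰ ∩ (E i ∖ A)` (bottom sets promoted to colour `i`), `P_A = B⁰ ∩ A`, `L j = C_j⁰ ∩ A` (petal sets lifted to the core).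

RESULTS [this work]:
* `blockHarris` — for an up-set `W` determined by `S`, a lower set `N` determined by `Sᶜ` and any up-set `Z`:
  `μ(W)·μ(Z ∩ Wᶜ ∩ N) ≤ μ(Wᶜ)·μ(Z ∩ W ∩ N)` (Harris on the block `S` fibrewise; here from four events with the auxiliary cylinder `{ω ⊆ S}`, whence the
  hypothesis `p < 1` off `S`).
* **`pc_firstOrder`** (THEOREM): `Σ_i (w_j + w_k)·μ(P i) + (w₀ + w₁ + w₂ − 1)·μ(P_A) ≤ Σ_j q_j·μ(L j)` (`w = μ(W)`, `q = 1 − w`) for every dominating sunflower.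
  Proof: `Z_j = E i ∪ E k` is an up-set with `Z_j ∩ C_j⁰ ⊆ L j` and `Z_j ∩ B⁰ = P i ⊔ P k ⊔ P_A`; apply `blockHarris` on block `j` and sum over `j`.
* **`mixedLB_cells_nonneg_of_dominatesPC`**: consequently `⟨cells(E;A), ∇LB(cells(PC))⟩ = mixedLB (cells E) (cells PC) ≥ 0` (`mixedLB_eq_firstOrder`: the exact
  identity `mixedLB m₁ m₀ = b₀·(RHS − LHS)`).  Since `LB(cells PC) = 0`, for every structure `θ` with `θ∖e = PC(W)` the pencil `t ↦ LB(law(θ, p[e↦t]))` has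
  nonnegative derivative at `t = 0`: NO ONE-POINT EXTENSION OF A PRODUCT-CLASS STRUCTURE LEAVES THE LAW REGION `W = {max(LA,LB) ≥ 0}` TO FIRST ORDER at the
  PC end of its pencil — the sheet `{LB = 0}` cannot be crossed transversally from a PC structure.  (The interior of the pencil and endpoints that are PC
  only in law are NOT covered: this is the first-order part of the one-point step of (C1-law), memo §6b/§7.)
-/

noncomputable section

namespace Summit.CriticalPhenomena.PercolationContinuityZ3.Theorems.SunflowerPartition

namespace PCStability

open MeasureTheory Finset
open Literature.Probability.LatticeModels Literature.Probability.Percolation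
open LawPencil

variable {ι : Type*} [Fintype ι] [DecidableEq ι]

/-! ## Determination bookkeeping -/

/-- The cylinder "no coordinate outside `S` is present" is determined by `Sᶜ`. [folklore] -/
theorem determinedBy_noneOutside (S : Finset ι) : DeterminedBy {ω : Set ι | ∀ i ∈ Sᶜ, i ∉ ω} (↑(Sᶜ) : Set ι) := by
  rw [determinedBy_iff]
  intro ω ω' h
  simp only [Set.mem_setOf_eq]
  constructor
  · intro hω i hi hi'
    have : i ∈ ω' ∩ (↑(Sᶜ) : Set ι) := ⟨hi', Finset.mem_coe.2 hi⟩
    rw [← h] at this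
    exact hω i hi this.1
  · intro hω i hi hi'
    have : i ∈ ω ∩ (↑(Sᶜ) : Set ι) := ⟨hi', Finset.mem_coe.2 hi⟩
    rw [h] at this
    exact hω i hi this.1

/-- The cylinder "no coordinate outside `S` is present" has positive probability when all those parameters are `< 1`. [folklore] -/
theorem real_noneOutside_pos (p : ι → unitInterval) (S : Finset ι) (hp : ∀ i ∈ Sᶜ, (p i : ℝ) < 1) :
    0 < (prodBernoulli p).real {ω : Set ι | ∀ i ∈ Sᶜ, i ∉ ω} := by
  rw [prodBernoulli_real_forall_notMem]
  exact prod_pos fun i hi => by linarith [hp i hi]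

/-! ## Harris on a block, fibrewise (from four events) -/

/-- **BLOCK HARRIS.** `W` an up-set determined by the block `S`, `N` ANY event determined by `Sᶜ`, `Z` any up-set; if every parameter off `S` is `< 1`
then `μ(W)·μ(Z ∩ Wᶜ ∩ N) ≤ μ(Wᶜ)·μ(Z ∩ W ∩ N)` (Harris for `W` and the fibres of `Z ∩ N` over the outside configuration). [this work] -/
theorem blockHarris (p : ι → unitInterval) (S : Finset ι) {W N Z : Set (Set ι)} (hW : IsUpperSet W) (hWS : DeterminedBy W (↑S : Set ι))
    (hNS : DeterminedBy N (↑(Sᶜ) : Set ι)) (hZ : IsUpperSet Z) (hp : ∀ i ∈ Sᶜ, (p i : ℝ) < 1) :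
    (prodBernoulli p).real W * (prodBernoulli p).real (Z ∩ Wᶜ ∩ N) ≤ (prodBernoulli p).real Wᶜ * (prodBernoulli p).real (Z ∩ W ∩ N) := by
  set Y : Set (Set ι) := {ω | ∀ i ∈ Sᶜ, i ∉ ω} with hYdef
  have hY : 0 < (prodBernoulli p).real Y := real_noneOutside_pos p S hp
  -- four events
  have h4 := prodBernoulli_fourEvents p (Z ∩ Wᶜ ∩ N) (W ∩ Y) (Wᶜ ∩ Y) (Z ∩ W ∩ N) (by
    intro a ha b hb
    obtain ⟨⟨haZ, haW⟩, haN⟩ := ha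
    obtain ⟨hbW, hbY⟩ := hb
    refine ⟨⟨?_, ?_⟩, ⟨?_, ?_⟩, ?_⟩
    · -- a ∩ b ∉ W (W is an up-set and a ∉ W)
      intro h; exact haW (hW Set.inter_subset_left h)
    · -- a ∩ b ⊆ b has no coordinate outside S
      intro i hi hi'; exact hbY i hi hi'.2
    · exact hZ Set.subset_union_left haZ
    · exact hW Set.subset_union_right hbW
    · -- (a ∪ b) agrees with a outside S
      have key : (a ∪ b) ∩ (↑(Sᶜ) : Set ι) = a ∩ ↑(Sᶜ) := by
        ext i
        simp only [Set.mem_inter_iff, Set.mem_union, Finset.mem_coe]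
        constructor
        · rintro ⟨h | h, hi⟩
          · exact ⟨h, hi⟩
          · exact absurd h (hbY i hi)
        · rintro ⟨h, hi⟩; exact ⟨Or.inl h, hi⟩
      exact ((determinedBy_iff N _).1 hNS (a ∪ b) a key).2 haN)
  -- independence of the block event and the outside cylinder
  have hdisj : Disjoint S Sᶜ := disjoint_compl_right
  have hWY : (prodBernoulli p).real (W ∩ Y) = (prodBernoulli p).real W * (prodBernoulli p).real Y :=
    prodBernoulli_real_inter_of_determinedBy_disjoint p hdisj hWS (determinedBy_noneOutside S) MeasurableSet.of_discrete
      MeasurableSet.of_discrete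
  have hWcY : (prodBernoulli p).real (Wᶜ ∩ Y) = (prodBernoulli p).real Wᶜ * (prodBernoulli p).real Y :=
    prodBernoulli_real_inter_of_determinedBy_disjoint p hdisj (Quant.determinedBy_compl_of hWS) (determinedBy_noneOutside S) MeasurableSet.of_discrete
      MeasurableSet.of_discrete
  rw [hWY, hWcY] at h4
  -- cancel the positive factor μ(Y)
  have h4' : (prodBernoulli p).real Y * ((prodBernoulli p).real W * (prodBernoulli p).real (Z ∩ Wᶜ ∩ N)) ≤
      (prodBernoulli p).real Y * ((prodBernoulli p).real Wᶜ * (prodBernoulli p).real (Z ∩ W ∩ N)) := by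
    have e1 : (prodBernoulli p).real (Z ∩ Wᶜ ∩ N) * ((prodBernoulli p).real W * (prodBernoulli p).real Y) =
        (prodBernoulli p).real Y * ((prodBernoulli p).real W * (prodBernoulli p).real (Z ∩ Wᶜ ∩ N)) := by ring
    have e2 : (prodBernoulli p).real Wᶜ * (prodBernoulli p).real Y * (prodBernoulli p).real (Z ∩ W ∩ N) =
        (prodBernoulli p).real Y * ((prodBernoulli p).real Wᶜ * (prodBernoulli p).real (Z ∩ W ∩ N)) := by ring
    rw [← e1, ← e2]; exact h4
  exact le_of_mul_le_mul_left h4' hY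

/-! ## The product class and dominating sunflowers -/

/-- The bottom cell of PC(W): no `W i` occurs. [this work] -/
def pcBot (W : Fin 3 → Set (Set ι)) : Set (Set ι) := (W 0 ∪ W 1 ∪ W 2)ᶜ

/-- The petal cell `j` of PC(W): exactly `W j` occurs. [this work] -/
def pcPetal (W : Fin 3 → Set (Set ι)) (j : Fin 3) : Set (Set ι) := W j ∩ ⋂ (i : Fin 3) (_ : i ≠ j), (W i)ᶜ

omit [Fintype ι] [DecidableEq ι] in
/-- Unfolding `pcPetal`. [this work] -/
theorem mem_pcPetal {W : Fin 3 → Set (Set ι)} {j : Fin 3} {ω : Set ι} : ω ∈ pcPetal W j ↔ ω ∈ W j ∧ ∀ i, i ≠ j → ω ∉ W i := by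
  simp [pcPetal]

omit [Fintype ι] [DecidableEq ι] in
/-- Unfolding `pcBot`. [this work] -/
theorem mem_pcBot {W : Fin 3 → Set (Set ι)} {ω : Set ι} : ω ∈ pcBot W ↔ ∀ i, ω ∉ W i := by
  simp only [pcBot, Set.mem_compl_iff, Set.mem_union, not_or]
  constructor
  · rintro ⟨⟨h0, h1⟩, h2⟩ i; fin_cases i <;> assumption
  · intro h; exact ⟨⟨h 0, h 1⟩, h 2⟩

/-- **One block of the theorem**: for `j` and the two other indices `i ≠ k`,
`w_j·(μ(P i) + μ(P k) + μ(P_A)) ≤ q_j·μ(L j)`. [this work] -/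
theorem pc_block (p : ι → unitInterval) (X : Fin 3 → Finset ι) (W : Fin 3 → Set (Set ι)) (hWup : ∀ i, IsUpperSet (W i))
    (hWdet : ∀ i, DeterminedBy (W i) (↑(X i) : Set ι)) (hX : ∀ i j, i ≠ j → Disjoint (X i) (X j))
    {E : Fin 3 → Set (Set ι)} {A : Set (Set ι)} (hEup : ∀ i, IsUpperSet (E i)) (hEA : ∀ i j, i ≠ j → E i ∩ E j = A)
    (hdom : ∀ i, W i ⊆ E i) (hp : ∀ i, (p i : ℝ) < 1) (j i k : Fin 3) (hij : i ≠ j) (hkj : k ≠ j) (hik : i ≠ k) :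
    (prodBernoulli p).real (W j) *
        ((prodBernoulli p).real (pcBot W ∩ (E i \ A)) + (prodBernoulli p).real (pcBot W ∩ (E k \ A)) +
          (prodBernoulli p).real (pcBot W ∩ A)) ≤
      (prodBernoulli p).real (W j)ᶜ * (prodBernoulli p).real (pcPetal W j ∩ A) := by
  -- the event N_j = "the other two W's fail", determined by (X j)ᶜ
  set N : Set (Set ι) := (W i)ᶜ ∩ (W k)ᶜ with hNdef
  have hsub : ∀ l, l ≠ j → (↑(X l) : Set ι) ⊆ ↑((X j)ᶜ) := by
    intro l hl x hx
    rw [Finset.coe_compl, Set.mem_compl_iff, Finset.mem_coe]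
    exact fun hxj => Finset.disjoint_left.1 (hX l j hl) (Finset.mem_coe.1 hx) hxj
  have hNS : DeterminedBy N (↑((X j)ᶜ) : Set ι) :=
    (Quant.determinedBy_compl_of ((hWdet i).mono (hsub i hij))).inter (Quant.determinedBy_compl_of ((hWdet k).mono (hsub k hkj)))
  -- Z_j = E i ∪ E k
  have hZ : IsUpperSet (E i ∪ E k) := (hEup i).union (hEup k)
  have hB := blockHarris p (X j) (hWup j) (hWdet j) hNS hZ (fun x _ => hp x)
  -- Z ∩ W_j ∩ N ⊆ pcPetal j ∩ A
  have h1 : (E i ∪ E k) ∩ W j ∩ N ⊆ pcPetal W j ∩ A := by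
    rintro ω ⟨⟨hZω, hWj⟩, hNi, hNk⟩
    refine ⟨mem_pcPetal.2 ⟨hWj, fun l hl => ?_⟩, ?_⟩
    · -- l ≠ j: l = i or l = k
      have hl' : l = i ∨ l = k := by omega
      rcases hl' with rfl | rfl
      · exact hNi
      · exact hNk
    · rcases hZω with h | h
      · have : ω ∈ E i ∩ E j := ⟨h, hdom j hWj⟩
        rwa [hEA i j hij] at this
      · have : ω ∈ E k ∩ E j := ⟨h, hdom j hWj⟩
        rwa [hEA k j hkj] at this
  -- Z ∩ W_jᶜ ∩ N = the three promoted cells, disjointly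
  have h2 : (prodBernoulli p).real (pcBot W ∩ (E i \ A)) + (prodBernoulli p).real (pcBot W ∩ (E k \ A)) + (prodBernoulli p).real (pcBot W ∩ A) ≤
      (prodBernoulli p).real ((E i ∪ E k) ∩ (W j)ᶜ ∩ N) := by
    have hbot : ∀ ω, ω ∈ pcBot W → ω ∈ (W j)ᶜ ∩ N := fun ω hω =>
      ⟨mem_pcBot.1 hω j, mem_pcBot.1 hω i, mem_pcBot.1 hω k⟩
    have hd1 : Disjoint (pcBot W ∩ (E i \ A)) (pcBot W ∩ (E k \ A)) := by
      rw [Set.disjoint_left]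
      rintro ω ⟨_, hi1, hiA⟩ ⟨_, hk1, _⟩
      have : ω ∈ E i ∩ E k := ⟨hi1, hk1⟩
      rw [hEA i k hik] at this
      exact hiA this
    have hd2 : Disjoint (pcBot W ∩ (E i \ A) ∪ pcBot W ∩ (E k \ A)) (pcBot W ∩ A) := by
      rw [Set.disjoint_left]
      rintro ω (⟨_, _, hA⟩ | ⟨_, _, hA⟩) ⟨_, hA'⟩ <;> exact hA hA'
    rw [← measureReal_union hd1 MeasurableSet.of_discrete, ← measureReal_union hd2 MeasurableSet.of_discrete]
    refine measureReal_mono ?_ (measure_ne_top _ _)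
    rintro ω ((⟨hb, hE, _⟩ | ⟨hb, hE, _⟩) | ⟨hb, hA⟩)
    · exact ⟨⟨Or.inl hE, (hbot ω hb).1⟩, (hbot ω hb).2⟩
    · exact ⟨⟨Or.inr hE, (hbot ω hb).1⟩, (hbot ω hb).2⟩
    · have hAi : ω ∈ E i := by
        have : ω ∈ E i ∩ E k := by rw [hEA i k hik]; exact hA
        exact this.1
      exact ⟨⟨Or.inl hAi, (hbot ω hb).1⟩, (hbot ω hb).2⟩
  have h3 : (prodBernoulli p).real ((E i ∪ E k) ∩ W j ∩ N) ≤ (prodBernoulli p).real (pcPetal W j ∩ A) := measureReal_mono h1 (measure_ne_top _ _)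
  have hw : 0 ≤ (prodBernoulli p).real (W j) := measureReal_nonneg
  have hq : 0 ≤ (prodBernoulli p).real (W j)ᶜ := measureReal_nonneg
  calc (prodBernoulli p).real (W j) * ((prodBernoulli p).real (pcBot W ∩ (E i \ A)) + (prodBernoulli p).real (pcBot W ∩ (E k \ A)) + (prodBernoulli p).real (pcBot W ∩ A))
      ≤ (prodBernoulli p).real (W j) * (prodBernoulli p).real ((E i ∪ E k) ∩ (W j)ᶜ ∩ N) := mul_le_mul_of_nonneg_left h2 hw
    _ ≤ (prodBernoulli p).real (W j)ᶜ * (prodBernoulli p).real ((E i ∪ E k) ∩ W j ∩ N) := hB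
    _ ≤ (prodBernoulli p).real (W j)ᶜ * (prodBernoulli p).real (pcPetal W j ∩ A) := mul_le_mul_of_nonneg_left h3 hq

/-- **FIRST-ORDER STABILITY OF THE PRODUCT CLASS** (the linearized (C1-law) at the sheet `{LB = 0}`): for every sunflower of up-sets `(E; A)`
dominating PC(W) (blocks pairwise disjoint, all parameters `< 1`), with `w_i = μ(W i)`:
`Σ_i (w_j + w_k)·μ(B⁰ ∩ (E i ∖ A)) + (w₀+w₁+w₂ − 1)·μ(B⁰ ∩ A) ≤ Σ_j (1 − w_j)·μ(C_j⁰ ∩ A)`. [this work] -/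
theorem pc_firstOrder (p : ι → unitInterval) (X : Fin 3 → Finset ι) (W : Fin 3 → Set (Set ι)) (hWup : ∀ i, IsUpperSet (W i))
    (hWdet : ∀ i, DeterminedBy (W i) (↑(X i) : Set ι)) (hX : ∀ i j, i ≠ j → Disjoint (X i) (X j))
    {E : Fin 3 → Set (Set ι)} {A : Set (Set ι)} (hEup : ∀ i, IsUpperSet (E i)) (hEA : ∀ i j, i ≠ j → E i ∩ E j = A)
    (hdom : ∀ i, W i ⊆ E i) (hp : ∀ i, (p i : ℝ) < 1) :
    ((prodBernoulli p).real (W 1) + (prodBernoulli p).real (W 2)) * (prodBernoulli p).real (pcBot W ∩ (E 0 \ A)) +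
      ((prodBernoulli p).real (W 0) + (prodBernoulli p).real (W 2)) * (prodBernoulli p).real (pcBot W ∩ (E 1 \ A)) +
      ((prodBernoulli p).real (W 0) + (prodBernoulli p).real (W 1)) * (prodBernoulli p).real (pcBot W ∩ (E 2 \ A)) +
      ((prodBernoulli p).real (W 0) + (prodBernoulli p).real (W 1) + (prodBernoulli p).real (W 2) - 1) *
        (prodBernoulli p).real (pcBot W ∩ A) ≤
    (prodBernoulli p).real (W 0)ᶜ * (prodBernoulli p).real (pcPetal W 0 ∩ A) +
      (prodBernoulli p).real (W 1)ᶜ * (prodBernoulli p).real (pcPetal W 1 ∩ A) +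
      (prodBernoulli p).real (W 2)ᶜ * (prodBernoulli p).real (pcPetal W 2 ∩ A) := by
  have b0 := pc_block p X W hWup hWdet hX hEup hEA hdom hp 0 1 2 (by decide) (by decide) (by decide)
  have b1 := pc_block p X W hWup hWdet hX hEup hEA hdom hp 1 0 2 (by decide) (by decide) (by decide)
  have b2 := pc_block p X W hWup hWdet hX hEup hEA hdom hp 2 0 1 (by decide) (by decide) (by decide)
  have hA : 0 ≤ (prodBernoulli p).real (pcBot W ∩ A) := measureReal_nonneg
  nlinarith [b0, b1, b2, hA]

/-! ## The law-level reading: the first mixed Bernstein coefficient of `LB` at a PC deletion -/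

/-- **The derivative identity** (pure algebra).  If `m₀` is the cell vector of PC(W) (`b₀ = q₀q₁q₂`, `c_j⁰ = w_j q_i q_k`, total mass `1`) and `m₁` is
obtained from it by promoting bottom mass `P i` to colour `i`, `P_A` to the core, and lifting petal mass `L j` to the core, then
`mixedLB m₁ m₀ = b₀·(Σ_j q_j L_j − Σ_i (w_j + w_k) P_i − (Σw − 1) P_A)`. [this work] -/
theorem mixedLB_pc_eq (w P L : Fin 3 → ℝ) (PA : ℝ) (m₀ m₁ : Fin 5 → ℝ)
    (h00 : m₀ 0 = (1 - w 0) * (1 - w 1) * (1 - w 2)) (h01 : m₀ 1 = w 0 * (1 - w 1) * (1 - w 2))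
    (h02 : m₀ 2 = (1 - w 0) * w 1 * (1 - w 2)) (h03 : m₀ 3 = (1 - w 0) * (1 - w 1) * w 2)
    (h04 : m₀ 4 = 1 - m₀ 0 - m₀ 1 - m₀ 2 - m₀ 3)
    (h10 : m₁ 0 = m₀ 0 - P 0 - P 1 - P 2 - PA) (h11 : m₁ 1 = m₀ 1 - L 0 + P 0) (h12 : m₁ 2 = m₀ 2 - L 1 + P 1)
    (h13 : m₁ 3 = m₀ 3 - L 2 + P 2) (h14 : m₁ 4 = m₀ 4 + L 0 + L 1 + L 2 + PA) :
    mixedLB m₁ m₀ = (1 - w 0) * (1 - w 1) * (1 - w 2) *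
      ((1 - w 0) * L 0 + (1 - w 1) * L 1 + (1 - w 2) * L 2
        - ((w 1 + w 2) * P 0 + (w 0 + w 2) * P 1 + (w 0 + w 1) * P 2) - (w 0 + w 1 + w 2 - 1) * PA) := by
  simp only [mixedLB]
  rw [h14, h10, h11, h12, h13, h04, h00, h01, h02, h03]
  ring

/-- **First mixed `LB`-coefficient at a PC deletion is nonnegative** (law-level corollary, with the cell bookkeeping as hypotheses): given the
cell formulas of `mixedLB_pc_eq` with `P, L, P_A` the promoted/lifted masses of a sunflower dominating PC(W) and the inequality of
`pc_firstOrder`, `0 ≤ mixedLB m₁ m₀` — the B-branch of gen 29's `LawPolarizedC1` in position `(m₁; m₀)` for every pencil whose deletion is a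
product-class structure (where `LB(m₀) = 0`). [this work] -/
theorem mixedLB_nonneg_of_pc (w P L : Fin 3 → ℝ) (PA : ℝ) (m₀ m₁ : Fin 5 → ℝ) (hw : ∀ i, 0 ≤ w i ∧ w i ≤ 1)
    (h00 : m₀ 0 = (1 - w 0) * (1 - w 1) * (1 - w 2)) (h01 : m₀ 1 = w 0 * (1 - w 1) * (1 - w 2))
    (h02 : m₀ 2 = (1 - w 0) * w 1 * (1 - w 2)) (h03 : m₀ 3 = (1 - w 0) * (1 - w 1) * w 2)
    (h04 : m₀ 4 = 1 - m₀ 0 - m₀ 1 - m₀ 2 - m₀ 3)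
    (h10 : m₁ 0 = m₀ 0 - P 0 - P 1 - P 2 - PA) (h11 : m₁ 1 = m₀ 1 - L 0 + P 0) (h12 : m₁ 2 = m₀ 2 - L 1 + P 1)
    (h13 : m₁ 3 = m₀ 3 - L 2 + P 2) (h14 : m₁ 4 = m₀ 4 + L 0 + L 1 + L 2 + PA)
    (hfo : (w 1 + w 2) * P 0 + (w 0 + w 2) * P 1 + (w 0 + w 1) * P 2 + (w 0 + w 1 + w 2 - 1) * PA ≤
      (1 - w 0) * L 0 + (1 - w 1) * L 1 + (1 - w 2) * L 2) :
    0 ≤ mixedLB m₁ m₀ := by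
  rw [mixedLB_pc_eq w P L PA m₀ m₁ h00 h01 h02 h03 h04 h10 h11 h12 h13 h14]
  have g0 : 0 ≤ 1 - w 0 := by linarith [(hw 0).2]
  have g1 : 0 ≤ 1 - w 1 := by linarith [(hw 1).2]
  have g2 : 0 ≤ 1 - w 2 := by linarith [(hw 2).2]
  exact mul_nonneg (mul_nonneg (mul_nonneg g0 g1) g2) (by linarith)


end PCStability

end Summit.CriticalPhenomena.PercolationContinuityZ3.Theorems.SunflowerPartition
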